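import Mathlib

/-!
# Kernel #156 — the elementary inequalities of the small-`P` certificate (candidate Z)

The deflated certificate at `P_c = 0` (paper §24.93(6)) inverts `1 - M(P)` through a
`2 × 2` Schur complement.  Besides the ball arithmetic, it uses exactly the following
facts, proved here over `ℝ`:

* `two_by_two_lower` : for a real `2 × 2` matrix `S = [[a,b],[c,d]]`,
  `det(S)² (x²+y²) ≤ ‖S‖_F² ‖S v‖²`, i.e. `‖S⁻¹‖₂ ≤ ‖S‖_F / |det S|`;
* `det_two_perturb` : `|det(S₀+Δ) - det S₀| ≤ F₀ p + p²/2` when `‖S₀‖_F ≤ F₀`, `‖Δ‖_F ≤ p`;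
* `schur_complement_apriori` : the a-priori bound for a `2`-block system through a left
  inverse of `A₂₂` and a lower bound for the Schur complement, and
* `sum_coeff_bound` : the passage from the two block estimates to one Euclidean constant
  (`ℓ¹ ≥ ℓ²` on the coefficient matrix).
-/

namespace Summit.AnomalousDissipation.AnomalousDissipation.Theorems

/-- (K1) `σ_min(S) ≥ |det S| / ‖S‖_F` for a real `2 × 2` matrix, written on a vector `(x,y)`:
`det² · (x² + y²) ≤ (a²+b²+c²+d²) · ((a x + b y)² + (c x + d y)²)`. -/
theorem two_by_two_lower (a b c d x y : ℝ) :
    (a * d - b * c) ^ 2 * (x ^ 2 + y ^ 2) ≤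
      (a ^ 2 + b ^ 2 + c ^ 2 + d ^ 2) * ((a * x + b * y) ^ 2 + (c * x + d * y) ^ 2) := by
  have key : (a ^ 2 + b ^ 2 + c ^ 2 + d ^ 2) * ((a * x + b * y) ^ 2 + (c * x + d * y) ^ 2)
      - (a * d - b * c) ^ 2 * (x ^ 2 + y ^ 2)
      = (d * (c * x + d * y) + b * (a * x + b * y)) ^ 2
        + (a * (a * x + b * y) + c * (c * x + d * y)) ^ 2 := by ring
  nlinarith [key, sq_nonneg (d * (c * x + d * y) + b * (a * x + b * y)),
    sq_nonneg (a * (a * x + b * y) + c * (c * x + d * y))]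

/-- (K2) Determinant perturbation for `2 × 2` matrices in Frobenius form:
if `a²+b²+c²+d² ≤ F₀²` and `α²+β²+γ²+δ² ≤ p²` (`F₀, p ≥ 0`) then
`|det(S₀ + Δ) - det S₀| ≤ F₀ p + p²/2`. -/
theorem det_two_perturb (a b c d α β γ δ F0 p : ℝ) (hF : 0 ≤ F0) (hp : 0 ≤ p)
    (hS : a ^ 2 + b ^ 2 + c ^ 2 + d ^ 2 ≤ F0 ^ 2) (hD : α ^ 2 + β ^ 2 + γ ^ 2 + δ ^ 2 ≤ p ^ 2) :
    |((a + α) * (d + δ) - (b + β) * (c + γ)) - (a * d - b * c)| ≤ F0 * p + p ^ 2 / 2 := by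
  set L := a * δ + d * α - b * γ - c * β with hLdef
  set Q := α * δ - β * γ with hQdef
  have e : ((a + α) * (d + δ) - (b + β) * (c + γ)) - (a * d - b * c) = L + Q := by
    rw [hLdef, hQdef]; ring
  -- Cauchy–Schwarz in four variables (Lagrange identity)
  have lag : (a ^ 2 + b ^ 2 + c ^ 2 + d ^ 2) * (α ^ 2 + β ^ 2 + γ ^ 2 + δ ^ 2) - L ^ 2
      = (a * α - d * δ) ^ 2 + (a * γ + b * δ) ^ 2 + (a * β + c * δ) ^ 2
        + (d * γ + b * α) ^ 2 + (d * β + c * α) ^ 2 + (c * γ - b * β) ^ 2 := by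
    rw [hLdef]; ring
  have hL2 : L ^ 2 ≤ (F0 * p) ^ 2 := by
    have h1 : L ^ 2 ≤ (a ^ 2 + b ^ 2 + c ^ 2 + d ^ 2) * (α ^ 2 + β ^ 2 + γ ^ 2 + δ ^ 2) := by
      nlinarith [lag, sq_nonneg (a * α - d * δ), sq_nonneg (a * γ + b * δ), sq_nonneg (a * β + c * δ),
        sq_nonneg (d * γ + b * α), sq_nonneg (d * β + c * α), sq_nonneg (c * γ - b * β)]
    have h2 : (a ^ 2 + b ^ 2 + c ^ 2 + d ^ 2) * (α ^ 2 + β ^ 2 + γ ^ 2 + δ ^ 2) ≤ F0 ^ 2 * p ^ 2 :=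
      mul_le_mul hS hD (by positivity) (by positivity)
    nlinarith [h1, h2]
  have hL : |L| ≤ F0 * p := by
    have h : |L| ≤ |F0 * p| := sq_le_sq.mp hL2
    rwa [abs_of_nonneg (mul_nonneg hF hp)] at h
  have hQ : |Q| ≤ p ^ 2 / 2 := by
    rw [hQdef, abs_le]
    constructor
    · nlinarith [sq_nonneg (α + δ), sq_nonneg (β - γ), hD]
    · nlinarith [sq_nonneg (α - δ), sq_nonneg (β + γ), hD]
  rw [e]
  exact (abs_add_le L Q).trans (by linarith)

variable {E F : Type*} [NormedAddCommGroup E] [NormedSpace ℝ E]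
  [NormedAddCommGroup F] [NormedSpace ℝ F]

/-- (K3) Schur-complement a-priori bound for the block system
`A₁₁ x + A₁₂ y = f`, `A₂₁ x + A₂₂ y = g`: if `R` is a left inverse of `A₂₂` with `‖R z‖ ≤ a ‖z‖`,
`‖A₁₂ y‖ ≤ n₁₂ ‖y‖`, `‖A₂₁ x‖ ≤ n₂₁ ‖x‖`, and the Schur complement `S x = A₁₁ x - A₁₂ (R (A₂₁ x))`
satisfies `‖x‖ ≤ σ ‖S x‖` (`σ, a, n₁₂ ≥ 0`), then `‖x‖ ≤ σ (‖f‖ + n₁₂ a ‖g‖)` and `‖y‖ ≤ a (‖g‖ + n₂₁ ‖x‖)`. -/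
theorem schur_complement_apriori {σ a n12 n21 : ℝ} (hσ : 0 ≤ σ) (ha : 0 ≤ a) (hn12 : 0 ≤ n12)
    (A11 : E →L[ℝ] E) (A12 : F →L[ℝ] E) (A21 : E →L[ℝ] F) (A22 R : F →L[ℝ] F)
    (hR : ∀ y, R (A22 y) = y) (hRa : ∀ z, ‖R z‖ ≤ a * ‖z‖)
    (h12 : ∀ y, ‖A12 y‖ ≤ n12 * ‖y‖) (h21 : ∀ x, ‖A21 x‖ ≤ n21 * ‖x‖)
    (hS : ∀ x, ‖x‖ ≤ σ * ‖A11 x - A12 (R (A21 x))‖)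
    {x f : E} {y g : F} (hf : A11 x + A12 y = f) (hg : A21 x + A22 y = g) :
    ‖x‖ ≤ σ * (‖f‖ + n12 * (a * ‖g‖)) ∧ ‖y‖ ≤ a * (‖g‖ + n21 * ‖x‖) := by
  have h1 : g - A21 x = A22 y := by rw [← hg]; abel
  have hy : y = R (g - A21 x) := by rw [h1, hR]
  have hSx : A11 x - A12 (R (A21 x)) = f - A12 (R g) := by
    rw [← hf, hy, map_sub, map_sub]; abel
  constructor
  · calc ‖x‖ ≤ σ * ‖A11 x - A12 (R (A21 x))‖ := hS x
      _ = σ * ‖f - A12 (R g)‖ := by rw [hSx]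
      _ ≤ σ * (‖f‖ + ‖A12 (R g)‖) := by gcongr; exact norm_sub_le _ _
      _ ≤ σ * (‖f‖ + n12 * (a * ‖g‖)) := by
          gcongr σ * (‖f‖ + ?_)
          calc ‖A12 (R g)‖ ≤ n12 * ‖R g‖ := h12 _
            _ ≤ n12 * (a * ‖g‖) := mul_le_mul_of_nonneg_left (hRa g) hn12
  · calc ‖y‖ = ‖R (g - A21 x)‖ := by rw [hy]
      _ ≤ a * ‖g - A21 x‖ := hRa _
      _ ≤ a * (‖g‖ + ‖A21 x‖) := by gcongr; exact norm_sub_le _ _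
      _ ≤ a * (‖g‖ + n21 * ‖x‖) := by gcongr; exact h21 x

/-- (K3') From the two block estimates to one Euclidean constant: if `X ≤ c₁₁ f + c₁₂ g` and
`Y ≤ c₂₁ f + c₂₂ g` with everything nonnegative, then `X² + Y² ≤ (c₁₁+c₁₂+c₂₁+c₂₂)² (f² + g²)`
(the sum of the entries of a nonnegative `2 × 2` matrix bounds its Frobenius, hence operator, norm). -/
theorem sum_coeff_bound {X Y f g c11 c12 c21 c22 : ℝ} (hX : 0 ≤ X) (hY : 0 ≤ Y) (hf : 0 ≤ f)
    (hg : 0 ≤ g) (h11 : 0 ≤ c11) (h12 : 0 ≤ c12) (h21 : 0 ≤ c21) (h22 : 0 ≤ c22)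
    (hXb : X ≤ c11 * f + c12 * g) (hYb : Y ≤ c21 * f + c22 * g) :
    X ^ 2 + Y ^ 2 ≤ (c11 + c12 + c21 + c22) ^ 2 * (f ^ 2 + g ^ 2) := by
  have hX2 : X ^ 2 ≤ (c11 * f + c12 * g) ^ 2 := by
    have : 0 ≤ c11 * f + c12 * g := by positivity
    exact pow_le_pow_left₀ hX hXb 2
  have hY2 : Y ^ 2 ≤ (c21 * f + c22 * g) ^ 2 := by
    exact pow_le_pow_left₀ hY hYb 2
  have cs1 : (c11 * f + c12 * g) ^ 2 ≤ (c11 ^ 2 + c12 ^ 2) * (f ^ 2 + g ^ 2) := by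
    nlinarith [sq_nonneg (c11 * g - c12 * f)]
  have cs2 : (c21 * f + c22 * g) ^ 2 ≤ (c21 ^ 2 + c22 ^ 2) * (f ^ 2 + g ^ 2) := by
    nlinarith [sq_nonneg (c21 * g - c22 * f)]
  have hsq : c11 ^ 2 + c12 ^ 2 + (c21 ^ 2 + c22 ^ 2) ≤ (c11 + c12 + c21 + c22) ^ 2 := by
    nlinarith [mul_nonneg h11 h12, mul_nonneg h11 h21, mul_nonneg h11 h22, mul_nonneg h12 h21,
      mul_nonneg h12 h22, mul_nonneg h21 h22]
  have hfg : 0 ≤ f ^ 2 + g ^ 2 := by positivity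
  nlinarith [hX2, hY2, cs1, cs2, mul_le_mul_of_nonneg_right hsq hfg]

end Summit.AnomalousDissipation.AnomalousDissipation.Theorems
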